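import Summits.ValiantsHypothesis.ValiantsHypothesis.Theorems.KPlusLogSqLawTropicalBIntervalOpt
import Summits.ValiantsHypothesis.ValiantsHypothesis.Theorems.KPlusLogSqLawTropicalBSplitDefs

/-!
# Route «KPlusLogSqLaw», crux `TropicalB` (stmt-ValiantsHypothesis-19771) — Hessenberg terms: stable column intervals, cuts
# and the block through the midpoint (structure lemmas for the Hessenberg sector theorem)

HONEST FRAMING.  Helper file (part 3 of 4: Defs → IntervalOpt → this → Hessenberg) toward the registered stubs `stub_tropThin` /
`stub_tropFat` of `Cruxes/TropicalB/Lines/birth.lean` (crux `TropicalB`, item stmt-ValiantsHypothesis-19771, route KPlusLogSqLaw,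
DRAFT; seat val-sym-trop-p5, desk docket D1(b)).  Nothing here proves any part of a stub; nothing asserts `TropicalB`,
`KPlusLogSqLaw`, `MatrixDescartes` (stmt-ValiantsHypothesis-18050) or anything about VP ≠ VNP.

CONTENT (all [folklore]).  (1) Atoms and the top of Gusfield's recursion: `card_optRestr_le_one_of_empty`,
`card_optRestr_le_of_card_le_one` (a column set with at most one column has `≤ mK + 1` optimal restrictions),
`chain_le_card_optRestr` (a dominant chain of `n + 1` pairwise distinct terms satisfying `Q` gives `n + 1 ≤ #optRestr univ Q`).
(2) Column intervals `ico m a c = [a, c)`, stability (`Stable J p`: `J` is a union of cycles of the permutation) and blocks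
(`IsBlock x y p`: the consecutive cycle `x → x+1 → ⋯ → y → x`): `ico_union`, `ico_eq_empty`, `ico_univ`, `image_eq_of_stable`,
`stable_union`, `stable_ico_of_stable`, `eq_on_block`, `image_eq_image_of_block`.  (3) HESSENBERG STRUCTURE (p1's
`IsHessenberg ε`: an entry `(a, b)` is present only if `a ≤ b + 1`): `row_le_of_present` (`σ i ≤ i + 1`), the CUT LEMMA
`stable_or_cross` (if `[a, c)` is stable then every cut `t < c` is a block boundary — `[a, t)` stable — or is crossed by the
subdiagonal entry `σ (t−1) = t`; pigeonhole on the image of `[a, t)`), and `exists_block` (the block `[x, y] ∋ t₀` with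
`[a, x)` and `[a, y+1)` stable, by `max'`/`min'` over the stable cuts).  So the present permutations of a Hessenberg design
are exactly the interval partitions of `[0, m)` — source–sink paths of a DAG (Gusfield 1980 / Carstensen 1983 setting).
-/

set_option linter.dupNamespace false
set_option autoImplicit false

namespace Summit.ValiantsHypothesis.ValiantsHypothesis.Theorems.KPlusLogSqLaw

open Summit.ValiantsHypothesis.ValiantsHypothesis.Theorems.MatrixDescartes.Negative
open Summit.ValiantsHypothesis.ValiantsHypothesis.Theorems.LacunarySymmetroidMatrixDescartes
open scoped BigOperators
open Finset

namespace IntervalOpt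

variable {m K : ℕ} {d : Fin K → ℕ} {v ε : Fin m → Fin m → Fin K → ℤ}

/-! ## 1. Atoms and the top -/

/-- the empty column set has at most one optimal restriction (`fun _ => none`). [folklore] -/
theorem card_optRestr_le_one_of_empty {J : Finset (Fin m)} (hJ : J = ∅)
    (Q : Equiv.Perm (Fin m) × (Fin m → Fin K) → Prop) : (optRestr d v ε J Q).card ≤ 1 := by
  classical
  have hsub : optRestr d v ε J Q ⊆ {fun _ => none} := by
    intro r hr
    obtain ⟨p, θ, _, _, rfl⟩ := mem_optRestr.1 hr
    rw [Finset.mem_singleton]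
    funext i
    exact restr_apply_of_not_mem (by rw [hJ]; exact Finset.notMem_empty i)
  calc (optRestr d v ε J Q).card ≤ ({fun _ => none} : Finset (Fin m → Option (Fin m × Fin K))).card :=
        Finset.card_le_card hsub
    _ = 1 := Finset.card_singleton _

/-- a column set with at most one column has at most `m·K + 1` optimal restrictions (the data at one column is an element
of `Fin m × Fin K`). [folklore] -/
theorem card_optRestr_le_of_card_le_one {J : Finset (Fin m)} (hJ : J.card ≤ 1)
    (Q : Equiv.Perm (Fin m) × (Fin m → Fin K) → Prop) : (optRestr d v ε J Q).card ≤ m * K + 1 := by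
  classical
  rcases Nat.eq_zero_or_pos J.card with h0 | h1
  · exact (card_optRestr_le_one_of_empty (Finset.card_eq_zero.1 h0) Q).trans (by omega)
  · obtain ⟨i, hi⟩ := Finset.card_eq_one.1 (le_antisymm hJ h1)
    have hsub : optRestr d v ε J Q ⊆
        (Finset.univ : Finset (Fin m × Fin K)).image fun q => fun j => if j ∈ J then some q else none := by
      intro r hr
      obtain ⟨p, θ, _, _, rfl⟩ := mem_optRestr.1 hr
      refine Finset.mem_image.2 ⟨(p.1 i, p.2 i), Finset.mem_univ _, ?_⟩
      funext j
      by_cases hj : j ∈ J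
      · have hji : j = i := by rw [hi] at hj; exact Finset.mem_singleton.1 hj
        rw [restr_apply_of_mem hj, if_pos hj, hji]
      · rw [restr_apply_of_not_mem hj, if_neg hj]
    calc (optRestr d v ε J Q).card ≤ _ := Finset.card_le_card hsub
      _ ≤ (Finset.univ : Finset (Fin m × Fin K)).card := Finset.card_image_le
      _ = m * K := by rw [Finset.card_univ, Fintype.card_prod, Fintype.card_fin, Fintype.card_fin]
      _ ≤ m * K + 1 := Nat.le_succ _

/-- **The top.**  A dominant chain of `n + 1` pairwise distinct terms all satisfying `Q` gives at least `n + 1` optimal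
restrictions on the full column set. [folklore] -/
theorem chain_le_card_optRestr {n : ℕ} (θ : Fin (n + 1) → ℤ)
    (p : Fin (n + 1) → Equiv.Perm (Fin m) × (Fin m → Fin K)) (hinj : Function.Injective p)
    (hdom : ∀ k, IsDominant d v ε (θ k) (p k))
    (Q : Equiv.Perm (Fin m) × (Fin m → Fin K) → Prop) (hQ : ∀ k, Q (p k)) :
    n + 1 ≤ (optRestr d v ε Finset.univ Q).card := by
  classical
  have hinj' : Function.Injective fun k => restr Finset.univ (p k) := fun k k' h =>
    hinj (eq_of_restr_eq_of_agreeOut h fun i hi => absurd (Finset.mem_univ i) hi)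
  calc n + 1 = (Finset.univ : Finset (Fin (n + 1))).card := by simp
    _ = ((Finset.univ : Finset (Fin (n + 1))).image fun k => restr Finset.univ (p k)).card :=
        (Finset.card_image_of_injective _ hinj').symm
    _ ≤ (optRestr d v ε Finset.univ Q).card := by
        refine Finset.card_le_card fun r hr => ?_
        obtain ⟨k, _, rfl⟩ := Finset.mem_image.1 hr
        exact mem_optRestr.2 ⟨p k, θ k, hQ k, inOpt_univ_of_isDominant (hdom k), rfl⟩

/-! ## 2. Column intervals, stability, blocks -/

/-- membership in a column interval. [folklore] -/
theorem mem_ico {a c : ℕ} {i : Fin m} : i ∈ ico m a c ↔ a ≤ (i : ℕ) ∧ (i : ℕ) < c := by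
  simp [ico]

/-- splitting a column interval at an intermediate cut. [folklore] -/
theorem ico_union {a b c : ℕ} (hab : a ≤ b) (hbc : b ≤ c) : ico m a c = ico m a b ∪ ico m b c := by
  ext i
  simp only [Finset.mem_union, mem_ico]
  omega

/-- the empty column interval. [folklore] -/
theorem ico_eq_empty {a c : ℕ} (h : c ≤ a) : ico m a c = ∅ := by
  ext i
  simp only [mem_ico, Finset.notMem_empty, iff_false]
  omega

/-- the full column interval. [folklore] -/
theorem ico_univ : ico m 0 m = Finset.univ := by
  ext i
  simp only [mem_ico, Finset.mem_univ, iff_true]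
  exact ⟨Nat.zero_le _, i.isLt⟩

/-- a one-column interval has at most one column. [folklore] -/
theorem card_ico_succ_le (t : ℕ) : (ico m t (t + 1)).card ≤ 1 := by
  rw [Finset.card_le_one]
  intro i hi j hj
  rw [mem_ico] at hi hj
  exact Fin.ext (by omega)

/-- a stable column set is mapped onto itself. [folklore] -/
theorem image_eq_of_stable {J : Finset (Fin m)} {p : Equiv.Perm (Fin m) × (Fin m → Fin K)} (h : Stable J p) :
    J.image p.1 = J := by
  ext j
  simp only [Finset.mem_image]
  constructor
  · rintro ⟨i, hi, rfl⟩
    exact (h i).1 hi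
  · intro hj
    refine ⟨p.1.symm j, (h _).2 (by simpa using hj), by simp⟩

/-- two terms stable on `J` have the same image of `J`. [folklore] -/
theorem image_eq_image_of_stable {J : Finset (Fin m)} {p p' : Equiv.Perm (Fin m) × (Fin m → Fin K)}
    (h : Stable J p) (h' : Stable J p') : J.image p.1 = J.image p'.1 := by
  rw [image_eq_of_stable h, image_eq_of_stable h']

/-- every term is stable on the full column set. [folklore] -/
theorem stable_univ (p : Equiv.Perm (Fin m) × (Fin m → Fin K)) : Stable Finset.univ p := fun i => by simp

/-- every term is stable on the empty column set. [folklore] -/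
theorem stable_empty (p : Equiv.Perm (Fin m) × (Fin m → Fin K)) : Stable ∅ p := fun i => by simp

/-- stability is closed under union. [folklore] -/
theorem stable_union {J₁ J₂ : Finset (Fin m)} {p : Equiv.Perm (Fin m) × (Fin m → Fin K)} (h1 : Stable J₁ p)
    (h2 : Stable J₂ p) : Stable (J₁ ∪ J₂) p := fun i => by
  rw [Finset.mem_union, Finset.mem_union, h1 i, h2 i]

/-- if `[a, b)` and `[a, c)` are stable (`a ≤ b`) then so is `[b, c)`. [folklore] -/
theorem stable_ico_of_stable {a b c : ℕ} {p : Equiv.Perm (Fin m) × (Fin m → Fin K)} (hab : a ≤ b)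
    (h1 : Stable (ico m a b) p) (h2 : Stable (ico m a c) p) : Stable (ico m b c) p := by
  intro i
  have e1 := h1 i
  have e2 := h2 i
  simp only [mem_ico] at e1 e2 ⊢
  omega

/-- two blocks on `[x, y]` agree there. [folklore] -/
theorem eq_on_block {x y : ℕ} {p p' : Equiv.Perm (Fin m) × (Fin m → Fin K)} (h : IsBlock x y p) (h' : IsBlock x y p')
    (i : Fin m) (hxi : x ≤ (i : ℕ)) (hiy : (i : ℕ) ≤ y) : p.1 i = p'.1 i := by
  apply Fin.ext
  rcases lt_or_eq_of_le hiy with hlt | heq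
  · rw [h.1 i hxi hlt, h'.1 i hxi hlt]
  · rw [h.2 i heq, h'.2 i heq]

/-- two blocks on `[x, y]` have the same image of every column set inside `[x, y+1)`. [folklore] -/
theorem image_eq_image_of_block {x y : ℕ} {J : Finset (Fin m)} (hJ : J ⊆ ico m x (y + 1))
    {p p' : Equiv.Perm (Fin m) × (Fin m → Fin K)} (h : IsBlock x y p) (h' : IsBlock x y p') :
    J.image p.1 = J.image p'.1 :=
  Finset.image_congr fun i hi => by
    have hi' := mem_ico.1 (hJ hi)
    exact eq_on_block h h' i hi'.1 (by omega)

/-! ## 3. Hessenberg structure: cuts and the block through the midpoint -/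

/-- a present term of a Hessenberg design has `σ i ≤ i + 1`. [folklore] -/
theorem row_le_of_present (hH : IsHessenberg ε) {p : Equiv.Perm (Fin m) × (Fin m → Fin K)} (hp : termSign ε p ≠ 0)
    (i : Fin m) : ((p.1 i : Fin m) : ℕ) ≤ (i : ℕ) + 1 :=
  hH _ _ _ ((termSign_ne_zero_iff ε p).1 hp i)

/-- **Cut lemma.**  If `[a, c)` is stable for a permutation with `σ i ≤ i + 1` and `t < c`, then either `[a, t)` is
stable or the cut at `t` is crossed by the subdiagonal entry `σ (t−1) = t`. [folklore] -/
theorem stable_or_cross {p : Equiv.Perm (Fin m) × (Fin m → Fin K)} (hrow : ∀ i : Fin m, ((p.1 i : Fin m) : ℕ) ≤ (i : ℕ) + 1)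
    {a c t : ℕ} (hst : Stable (ico m a c) p) (htc : t < c) :
    Stable (ico m a t) p ∨ ∃ i : Fin m, (i : ℕ) + 1 = t ∧ ((p.1 i : Fin m) : ℕ) = t := by
  classical
  by_cases hs : Stable (ico m a t) p
  · exact Or.inl hs
  right
  have key : ∃ i, i ∈ ico m a t ∧ p.1 i ∉ ico m a t := by
    by_contra hno
    push Not at hno
    apply hs
    intro i
    refine ⟨hno i, fun hσ => ?_⟩
    have hsub : (ico m a t).image p.1 ⊆ ico m a t := by
      intro j hj
      obtain ⟨i', hi', rfl⟩ := Finset.mem_image.1 hj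
      exact hno i' hi'
    have heq : (ico m a t).image p.1 = ico m a t :=
      Finset.eq_of_subset_of_card_le hsub (by rw [Finset.card_image_of_injective _ p.1.injective])
    rw [← heq] at hσ
    obtain ⟨i', hi', he⟩ := Finset.mem_image.1 hσ
    rwa [← p.1.injective he]
  obtain ⟨i, hi, hσi⟩ := key
  have h1 : p.1 i ∈ ico m a c := (hst i).1 (by rw [mem_ico] at hi ⊢; omega)
  rw [mem_ico] at hi h1 hσi
  have h2 := hrow i
  exact ⟨i, by omega, by omega⟩

/-- **The block through the midpoint.**  If `[a, c)` is stable for a permutation with `σ i ≤ i + 1` and `a ≤ t₀ < c`, there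
is a block `[x, y] ∋ t₀` of the permutation with `[a, x)` and `[a, y+1)` stable. [folklore] -/
theorem exists_block {p : Equiv.Perm (Fin m) × (Fin m → Fin K)} (hrow : ∀ i : Fin m, ((p.1 i : Fin m) : ℕ) ≤ (i : ℕ) + 1)
    {a c : ℕ} (hst : Stable (ico m a c) p) (t₀ : ℕ) (hat : a ≤ t₀) (htc : t₀ < c) :
    ∃ x y : ℕ, a ≤ x ∧ x ≤ t₀ ∧ t₀ ≤ y ∧ y < c ∧ Stable (ico m a x) p ∧ Stable (ico m a (y + 1)) p ∧ IsBlock x y p := by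
  classical
  -- `x`: the largest `t ≤ t₀` with `a ≤ t` and `[a, t)` stable
  set Sx := (Finset.range (t₀ + 1)).filter fun t => a ≤ t ∧ Stable (ico m a t) p with hSxdef
  have hax : a ∈ Sx := by
    rw [hSxdef, Finset.mem_filter, Finset.mem_range]
    exact ⟨by omega, le_rfl, by rw [ico_eq_empty le_rfl]; exact stable_empty p⟩
  have hSx : Sx.Nonempty := ⟨a, hax⟩
  obtain ⟨x, hxdef⟩ : ∃ x, x = Sx.max' hSx := ⟨_, rfl⟩
  have hx : x ∈ Sx := hxdef ▸ Finset.max'_mem _ _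
  rw [hSxdef, Finset.mem_filter, Finset.mem_range] at hx
  -- `y1`: the least `t` with `t₀ < t ≤ c` and `[a, t)` stable
  set Sy := (Finset.range (c + 1)).filter fun t => t₀ < t ∧ Stable (ico m a t) p with hSydef
  have hcy : c ∈ Sy := by
    rw [hSydef, Finset.mem_filter, Finset.mem_range]
    exact ⟨by omega, htc, hst⟩
  have hSy : Sy.Nonempty := ⟨c, hcy⟩
  obtain ⟨y1, hydef⟩ : ∃ y1, y1 = Sy.min' hSy := ⟨_, rfl⟩
  have hy : y1 ∈ Sy := hydef ▸ Finset.min'_mem _ _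
  rw [hSydef, Finset.mem_filter, Finset.mem_range] at hy
  -- every cut strictly between `x` and `y1` is crossed
  have hcross : ∀ t, x < t → t < y1 → ∃ i : Fin m, (i : ℕ) + 1 = t ∧ ((p.1 i : Fin m) : ℕ) = t := by
    intro t hxt hty
    rcases stable_or_cross hrow hst (show t < c by omega) with hs | hc
    · exfalso
      by_cases ht : t ≤ t₀
      · have hmem : t ∈ Sx := by
          rw [hSxdef, Finset.mem_filter, Finset.mem_range]
          exact ⟨by omega, by omega, hs⟩
        have := Finset.le_max' Sx t hmem
        omega
      · have hmem : t ∈ Sy := by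
          rw [hSydef, Finset.mem_filter, Finset.mem_range]
          exact ⟨by omega, by omega, hs⟩
        have := Finset.min'_le Sy t hmem
        omega
    · exact hc
  have hy1 : y1 - 1 + 1 = y1 := by omega
  refine ⟨x, y1 - 1, hx.2.1, by omega, by omega, by omega, hx.2.2, by rw [hy1]; exact hy.2.2, ?_, ?_⟩
  · intro i hxi hiy
    obtain ⟨i', hi', hσ⟩ := hcross ((i : ℕ) + 1) (by omega) (by omega)
    have : i' = i := Fin.ext (by omega)
    subst this
    exact hσ
  · intro i hiy
    have hstab : Stable (ico m x y1) p := stable_ico_of_stable (by omega) hx.2.2 hy.2.2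
    have h1 : p.1 i ∈ ico m x y1 := (hstab i).1 (by rw [mem_ico]; omega)
    rw [mem_ico] at h1
    by_contra hne
    obtain ⟨j, hj, hσj⟩ := hcross ((p.1 i : Fin m) : ℕ) (by omega) (by omega)
    have hji : j = i := p.1.injective (Fin.ext (by omega))
    subst hji
    omega

end IntervalOpt

end Summit.ValiantsHypothesis.ValiantsHypothesis.Theorems.KPlusLogSqLaw
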